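import Summits.CriticalPhenomena.PercolationContinuityZ3.Theorems.Transplant.SkelPhiConcRealised
import Summits.CriticalPhenomena.PercolationContinuityZ3.Theorems.Transplant.SkelPhiConcScheduleN
import Summits.CriticalPhenomena.PercolationContinuityZ3.Theorems.Transplant.SkelPhiCellsWeakG
import HarnessLib

/-!
# N1 (the `{±1}` node), (C) column file (C-A6b): THE REALISED ANCHORS AND THE (C) HABITAT RADII OF THE N1 SCHEME OF RECORD — `cellGeomSG₂` over any
# planar map (hp-8) with stmt-g13's radius schedule `concRadii2N P gap gap' E₀ L' off` (column-offset slot): the D″ facts of `SkelPhiConcRealised`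
# re-typed by the dictionary `cellGeomSG ↦ cellGeomSG₂`, `concRadii2S ↦ concRadii2N … off` (the slot is inactive at run pairs under a linear bound
# `off x ≤ c·‖x‖₁ + 1`, `c ≤ gap`).

builds on p205010 (kernel theorem, internal audit signed; external expert review pending) — nothing in this file uses p205010; nothing here is a
claim about the open node `SamePDropOfSkeletonNeg`.
Lane `prim-bschramm`, seat `prim-bschramm-p5` (gen 8; (C) lineage); helper file (`--supports stmt-CriticalPhenomena-4575`).

* `cellGeomSG₂_anchor`, `cellGeomSG₂_a₀` (`rfl`), **`realised_of_choice_SG₂`**, **`tgt_add_stepVec_ne_zero₂`**, and **`reach_radii_concSG₂N`**: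
  at a chosen edge `e = (v → x)`, `α = aOf₁`, `β = aOf₂`, onward `du`, `E := Erad (nQ α x)`: `rQ α x = E`, `rB α v δ = E`, `ρ β x du ℓ = E − 2`,
  `rE β x du = Frad (nQ α x + 1) − 1`, `rM β (x+du) = Frad (nQ α x + 1) − L'`, `nQ α x = nS α v + 1`.
[cite: KozmaNitzan2024, §4 pp. 25–27 (the exploration process), p. 31 (the corridor step)]
-/

noncomputable section

open scoped Classical

namespace Summit.CriticalPhenomena.PercolationContinuityZ3.Theorems

namespace Transplant

namespace Skelφ

open Literature.Probability.Percolation Literature.Probability.LatticeModels SimpleGraph GadgetSystem Contour KNCells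
open Literature.Probability.Percolation.KozmaNitzan.Cells (stepVec_apply_fst stepVec_apply_oth)
open BoxProdZ2 (Realised ConcRadiiG nQ nS gen0 Erad Frad gen0_stepVec gen0_stepVec_add_stepVec)
open Skel (realised_of_choice l1_tgt_le_nQ nQ_tgt_eq_nS_src_succ)

variable {V : Type} [DecidableEq V] {G : SimpleGraph V} [G.LocallyFinite] {φ : V → Site 2}

/-! ## §1 The anchors of `cellGeomSG₂` -/

section SG

variable (G φ) (P : PCells2) (t : V) (Λ : ConcRadiiG) (q : unitInterval) (δc : ℝ)

/-- The re-centring rule of `cellGeomSG₂` is `a ↦ a + 1`. [folklore] -/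
theorem cellGeomSG₂_anchor : ∀ a v Q, (⟨cellGeomSG₂ G φ P t Λ, q, δc⟩ : KSchA V ℕ).Γ.anchor a v Q = a + 1 := fun _ _ _ => rfl

/-- The root anchor of `cellGeomSG₂` is `0`. [folklore] -/
theorem cellGeomSG₂_a₀ : (⟨cellGeomSG₂ G φ P t Λ, q, δc⟩ : KSchA V ℕ).Γ.a₀ = 0 := rfl

variable {G φ P t Λ q δc}

/-- **The anchors of a chosen edge of the N1 scheme of record are realised.** [folklore] -/
theorem realised_of_choice_SG₂ [Countable V] (h : ProbeHistory V) {e : Site 2 × MDir}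
    (hc : ((⟨cellGeomSG₂ G φ P t Λ, q, δc⟩ : KSchA V ℕ).astOf₂ G h).st.choice = some e) :
    Realised ((⟨cellGeomSG₂ G φ P t Λ, q, δc⟩ : KSchA V ℕ).aOf₁ G h e) ((⟨cellGeomSG₂ G φ P t Λ, q, δc⟩ : KSchA V ℕ).aOf₂ G h e) (tgt e) :=
  realised_of_choice (cellGeomSG₂_anchor G φ P t Λ q δc) (cellGeomSG₂_a₀ G φ P t Λ q δc) h hc

/-- **Onward targets are never the root cell** (root footprint `φ t = 0`): after a valid history the root is explored, so the column of the root
cell is not onward. [cite: KozmaNitzan2024, §4 p. 27 ((29))] -/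
theorem tgt_add_stepVec_ne_zero₂ [Countable V] (hφ : φ t = 0) {h : ProbeHistory V} {e : Site 2 × MDir}
    (hV : (⟨cellGeomSG₂ G φ P t Λ, q, δc⟩ : KSchA V ℕ).Valid₂ G h e) {du : MDir}
    (hdu : du ∈ (⟨cellGeomSG₂ G φ P t Λ, q, δc⟩ : KSchA V ℕ).onward G h (tgt e)) : tgt e + stepVec du ≠ 0 := by
  intro h0
  have hroot := hV.root_mem
  have hon := (Finset.mem_filter.1 hdu).2 _ hroot
  apply hon
  show φ t = P.cen (tgt e + stepVec du)
  rw [h0, PCells2.cen_zero, hφ]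

/-- The norm of a chosen target is below its cube count: `‖tgt e‖₁ ≤ nQ α (tgt e)` (`cellGeomSG₂`). [folklore] -/
theorem l1_tgt_le_nQ₂ [Countable V] (h : ProbeHistory V) {e : Site 2 × MDir}
    (hc : ((⟨cellGeomSG₂ G φ P t Λ, q, δc⟩ : KSchA V ℕ).astOf₂ G h).st.choice = some e) :
    ((tgt e) 0).natAbs + ((tgt e) 1).natAbs ≤ nQ ((⟨cellGeomSG₂ G φ P t Λ, q, δc⟩ : KSchA V ℕ).aOf₁ G h e) (tgt e) :=
  l1_tgt_le_nQ (cellGeomSG₂_anchor G φ P t Λ q δc) (cellGeomSG₂_a₀ G φ P t Λ q δc) h hc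

end SG

/-! ## §2 The (C) habitat radii at a chosen edge, over `concRadii2N` -/

section ReachRadii

variable {P : PCells2} {t : V} {gap gap' : ℕ → ℕ} {E₀ L' : ℕ} {off : Site 2 → ℕ} {q : unitInterval} {δc : ℝ}

/-- **The (C) habitat radii at a chosen edge of the N1 scheme of record** over `Λ = concRadii2N P gap gap' E₀ L' off` (`20·rmax ≤ gap`, the slot
linearly bounded `off x ≤ c·‖x‖₁ + 1` with `c ≤ gap`, `1 ≤ E₀`, root footprint `0`): with `E := Erad (nQ α x)`, `rQ α x = E`, `rB α v δ = E`,
`ρ β x du ℓ = E − 2`, `rE β x du = Frad (nQ α x + 1) − 1`, `rM β (x+du) = Frad (nQ α x + 1) − L'`, `nQ α x = nS α v + 1`. [this work] -/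
theorem reach_radii_concSG₂N [Countable V] (hgap : ∀ n, 20 * P.rmax ≤ gap n) {c : ℕ} (hgapc : ∀ n, c ≤ gap n)
    (hoff : ∀ x : Site 2, off x ≤ c * ((x 0).natAbs + (x 1).natAbs) + 1) (hE₀ : 1 ≤ E₀) (hφ : φ t = 0)
    {h : ProbeHistory V} {e : Site 2 × MDir}
    (hc : ((⟨cellGeomSG₂ G φ P t (concRadii2N P gap gap' E₀ L' off), q, δc⟩ : KSchA V ℕ).astOf₂ G h).st.choice = some e)
    (hV : (⟨cellGeomSG₂ G φ P t (concRadii2N P gap gap' E₀ L' off), q, δc⟩ : KSchA V ℕ).Valid₂ G h e) {du : MDir}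
    (hdu : du ∈ (⟨cellGeomSG₂ G φ P t (concRadii2N P gap gap' E₀ L' off), q, δc⟩ : KSchA V ℕ).onward G h (tgt e)) :
    let α := (⟨cellGeomSG₂ G φ P t (concRadii2N P gap gap' E₀ L' off), q, δc⟩ : KSchA V ℕ).aOf₁ G h e
    let β := (⟨cellGeomSG₂ G φ P t (concRadii2N P gap gap' E₀ L' off), q, δc⟩ : KSchA V ℕ).aOf₂ G h e
    (concRadii2N P gap gap' E₀ L' off).rQ α (tgt e) = Erad gap gap' E₀ (nQ α (tgt e)) ∧
    (concRadii2N P gap gap' E₀ L' off).rB α e.1 e.2 = Erad gap gap' E₀ (nQ α (tgt e)) ∧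
    (∀ ℓ, (concRadii2N P gap gap' E₀ L' off).ρ β (tgt e) du ℓ = Erad gap gap' E₀ (nQ α (tgt e)) - 2) ∧
    (concRadii2N P gap gap' E₀ L' off).rE β (tgt e) du = Frad gap gap' E₀ (nQ α (tgt e) + 1) - 1 ∧
    (concRadii2N P gap gap' E₀ L' off).rM β (tgt e + stepVec du) = Frad gap gap' E₀ (nQ α (tgt e) + 1) - L' ∧
    nQ α (tgt e) = nS α e.1 + 1 := by
  intro α β
  have hreal : Realised α β (tgt e) := realised_of_choice_SG₂ h hc
  have hy : tgt e + stepVec du ≠ 0 := tgt_add_stepVec_ne_zero₂ hφ hV hdu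
  obtain ⟨h1, h2, h3⟩ := hreal.sched_hyps hy
  refine ⟨?_, rfl, fun ℓ => ?_, ?_, ?_, ?_⟩
  · exact concRadii2N_rQ_eq_of_norm_le P gap' E₀ L' off hgap hgapc hE₀ (l1_tgt_le_nQ₂ h hc) (hoff _)
  · rw [concRadii2N_ρ_eq P gap gap' E₀ L' off h1 h2 ℓ, hreal.nS_eq]
  · rw [concRadii2N_rE_eq P gap gap' E₀ L' off h3, hreal.nS_eq]
  · rw [concRadii2N_rM, hreal.nQ_add_stepVec hy]
  · exact nQ_tgt_eq_nS_src_succ (cellGeomSG₂_anchor G φ P t _ q δc) (cellGeomSG₂_a₀ G φ P t _ q δc) h hc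

end ReachRadii

end Skelφ

end Transplant

end Summit.CriticalPhenomena.PercolationContinuityZ3.Theorems

end
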